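import Summits.BirchSwinnertonDyer.BirchSwinnertonDyer.Theorems.ClassRecordThreeEulerHalvesAtThreeJetchevMaxOfSwapLiterature
import Summits.BirchSwinnertonDyer.BirchSwinnertonDyer.Theorems.SchneiderFreeAdditiveX3PoitouTateUnramifiedOrthogonalAllLevels
import Literature.NumberTheory.GaloisCohomology.LocalInvariantMapConjCompatible
import HarnessLib

/-!
# The Poitou–Tate input `hPT` of 19109's Kolyvagin road (`stub_localFactsAtThree` conjunct 1,
# `poitouTate_selmerStructure_duality_conj K` for every number field) FROM ONE printed property of THE
# canonical local invariant maps — Milne *ADT* I Thm. 4.10(b) `⊇` ∕ Howard 2004 Thm. 2.1.11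
# (`(LocalInvariants.canonical K n).SelmerComplement`); Milne I Thm. 2.6 (`UnramifiedOrthogonal`) for the
# canonical family is a KERNEL THEOREM (cell `bsd-stepL`, seat `bsd-stepL-tam3-p1` g10; helper toward item 19109)

HONEST FRAMING. Theorems only; nothing here proves BSD or any case of Poitou–Tate duality beyond what the
tree already proves; the stub `stub_jetchevMaxHLAtThree` is displayed CONDITIONALLY (D-0014); no item
closes; 0 classes move (T7); `--supports stmt-BirchSwinnertonDyer-19109` (helper).

WHAT. The registered citable stub `stub_localFactsAtThree` of 19109's skeleton of record (`Lines/inert.lean`,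
RULING 37) reads `hPT ∧ hF1` with `hPT : ∀ K, poitouTate_selmerStructure_duality_conj K` — the EXISTENCE of
a family of local invariant maps with FIVE printed properties (`IsPerfect`, `SumLocalTermEqZero`,
`UnramifiedOrthogonal`, `SelmerComplement`, `IsConjCompatible`). For THE canonical family
`LocalInvariants.canonical K n` (`Literature/…/ArchimedeanInvariantMap.lean`) FOUR of the five are tree
theorems: `canonical_isPerfect` (Milne I Cor. 2.3), the reciprocity law
`sumInvLocalizationEqZero_canonical_of_numberField` (Tate, C–F VII §11; cell bsd-cn100),
`isConjCompatible_canonical` (cell bsd-jet pv-1 g10, p572786) — assembled by bsd-jet's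
`poitouTate_selmerStructure_duality_conj_of_canonical_numberField K hUO hSC` (p573425) — AND, shown here
to be available BY NAME, `UnramifiedOrthogonal` (Milne I Thm. 2.6): cell bsd-schneider's
`PoitouTateReduction.unramifiedOrthogonal_of_isPerfect_allLevels` (door-c4 g9: Thm. 2.6 for EVERY perfect
family at EVERY level, from Tate's local Euler–Poincaré count) applied to `canonical_isPerfect`.
Hence `hPT` follows from the SINGLE printed property
  `hSC : ∀ K n, (LocalInvariants.canonical K n).SelmerComplement`
(Milne I Thm. 4.10(b) `Ker γ¹ ⊆ Im β¹` ∕ Howard Thm. 2.1.11 — the class-formation half of Tate's theorem;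
the tree's `selmerComplement_canonical_of_middleExact_allLevels` reduces it further to the raw middle
exactness, proved by cell bsd-stepL koly g20 for modules of order `p²`, p574551).
* `unramifiedOrthogonal_canonical` — Milne I Thm. 2.6 for THE canonical family, every `K : Type`, every `n`.
* `poitouTate_conj_forall_of_selmerComplement_canonical : hSC → ∀ K, poitouTate_selmerStructure_duality_conj K`.
* `jetchevMaxHLAtThree_of_swapLiterature_of_canonical : h372 → hGZ → hmod → hSC → hF1 → ‹stub_jetchevMaxHLAtThree›`
  — this seat's p575764 display with its `hPT` fed by the previous theorem: the registered J-MAX input of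
  19109 modulo {Gross 3.7 (2) image-free, GZ86 I (6.3), modularity, Milne I 4.10(b) ⊇ for THE maps,
  GZ86 III (3.1) ∕ Gross §6}.
References (locators only): [cite: MilneADT2006, Ch. I, Cor. 2.3, Thm. 2.6, Thm. 4.10(b)]
[cite: Howard2004HeegnerKolyvagin, Thm. 2.1.11] [cite: CasselsFrohlichANT1967, Ch. VII §11]
[cite: Jetchev2008, Thm. 1.4 (p. 812)] [cite: GrossLMS1991, Prop. 3.7 (2), §6 Prop. 6.2 (1)]
[cite: GrossZagier1986, I (6.3), III (3.1)]. Design: three theorems, no definitions; `K : Type`. Axioms: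
`propext`, `Classical.choice`, `Quot.sound`.
-/

set_option autoImplicit false

noncomputable section

open scoped Classical NumberField

namespace Summit.BirchSwinnertonDyer.Rank1Residual.X11b.Three.Koly

open WeierstrassCurve IsDedekindDomain NumberField Field Literature.NumberTheory.EllipticCurves
  Literature.NumberTheory.EllipticCurves.ModularForms Literature.NumberTheory.EllipticCurves.Jetchev2008
  Literature.NumberTheory.EllipticCurves.KolyvaginCocycle
  Literature.NumberTheory.EllipticCurves.Rank1Residual Literature.NumberTheory.GaloisRepresentations
  Literature.NumberTheory.GaloisRepresentations.DiscreteGaloisModule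
  Literature.NumberTheory.GaloisCohomology Literature.NumberTheory.Automorphic
  Summit.BirchSwinnertonDyer.Rank1Residual.X11b Summit.BirchSwinnertonDyer.Rank1Residual.JET

/-- **Milne *ADT* I Thm. 2.6 for THE canonical local invariant maps**: at every number field `K : Type`
and every level `n ≥ 1`, the family `LocalInvariants.canonical K n` has `UnramifiedOrthogonal` (unramified
classes of an unramified `n`-torsion module and of its Tate dual are exact annihilators of each other under
THE local pairing at every `v ∤ n`) — cell bsd-schneider door-c4's `unramifiedOrthogonal_of_isPerfect_allLevels`
at `canonical_isPerfect`. A KERNEL THEOREM (no hypothesis). [cite: MilneADT2006, Ch. I, Thm. 2.6, Cor. 2.3] -/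
theorem unramifiedOrthogonal_canonical :
    ∀ (K : Type) [Field K] [NumberField K] (n : ℕ) [NeZero n],
      (LocalInvariants.canonical K n).UnramifiedOrthogonal :=
  fun K _ _ n _ ↦
    Summit.BirchSwinnertonDyer.BirchSwinnertonDyer.Theorems.SchneiderFreeAdditiveX3.PoitouTateReduction.unramifiedOrthogonal_of_isPerfect_allLevels
      (LocalInvariants.canonical K n) LocalInvariants.canonical_isPerfect

/-- **`hPT` (Poitou–Tate duality for Selmer structures, conjugation form, every number field) from the ONE
printed property `SelmerComplement` of THE canonical maps** (Milne I Thm. 4.10(b) `⊇` ∕ Howard 2004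
Thm. 2.1.11): bsd-jet's `poitouTate_selmerStructure_duality_conj_of_canonical_numberField` with its
`UnramifiedOrthogonal` input discharged by `unramifiedOrthogonal_canonical`. CONDITIONAL on `hSC` only.
[cite: MilneADT2006, Ch. I, Thm. 2.6, Thm. 4.10(b)] [cite: Howard2004HeegnerKolyvagin, Thm. 2.1.11]
[cite: CasselsFrohlichANT1967, Ch. VII §11] -/
theorem poitouTate_conj_forall_of_selmerComplement_canonical
    (hSC : ∀ (K : Type) [Field K] [NumberField K] (n : ℕ) [NeZero n],
      (LocalInvariants.canonical K n).SelmerComplement) :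
    ∀ (K : Type) [Field K] [NumberField K], poitouTate_selmerStructure_duality_conj K :=
  fun K _ _ ↦ poitouTate_selmerStructure_duality_conj_of_canonical_numberField K
    (unramifiedOrthogonal_canonical K) (hSC K)

/-- **`stub_jetchevMaxHLAtThree` VERBATIM modulo FIVE named printed inputs, the Poitou–Tate one being the
single property `SelmerComplement` of THE canonical maps**: {Gross 1991 Prop. 3.7 (2) image-free,
Gross–Zagier I (6.3), modularity, Milne I Thm. 4.10(b) `⊇` for `LocalInvariants.canonical`, Gross 1991 §6 ∕
[GZ86 III (3.1)]} — p575764's `jetchevMaxHLAtThree_of_swapLiterature` with `hPT` fed by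
`poitouTate_conj_forall_of_selmerComplement_canonical`. CONDITIONAL; the stub is NOT discharged; nothing
asserted about any curve. [cite: Jetchev2008, Thm. 1.4 (p. 812), Proof of Thm. 1.1 (pp. 820–824)]
[cite: MilneADT2006, Ch. I, Thm. 4.10(b)] [cite: GrossLMS1991, Prop. 3.7 (2), §6 Prop. 6.2 (1)]
[cite: GrossZagier1986, I (6.3), III (3.1)] -/
theorem jetchevMaxHLAtThree_of_swapLiterature_of_canonical
    -- NAMED PRINTED INPUTS (cite-only)
    (h372 : GrossLMS1991.prop37_2_frobeniusCongruence)
    (hGZ : ∀ (N : ℕ) [NeZero N] (W : WeierstrassCurve ℚ) (K : Type) [Field K] [NumberField K],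
      gross_zagier N W K)
    (hmod : hasEntireLFunction_rat)
    (hSC : ∀ (K : Type) [Field K] [NumberField K] (n : ℕ) [NeZero n],
      (LocalInvariants.canonical K n).SelmerComplement)
    (hF1 : Gross1991_heegnerPoint_sub_ratTorsion_mem_E0) :
    ∀ (W : WeierstrassCurve ℚ) [W.IsElliptic] [W.IsGloballyMinimal] [NeZero (W.conductorNorm ℤ)]
      (K : Type) [Field K] [NumberField K]
      (Dt : ModularParametrizationData W (W.conductorNorm ℤ)) (β : ℤ) (ι : K →+* ℂ),
      W.analyticRank = 1 → W.HasMultiplicativeReductionAtPrime 3 → Surj W 3 →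
      IsImaginaryQuadratic K → SatisfiesHeegnerHypothesis (W.conductorNorm ℤ) K →
      Odd (NumberField.discr K) → (W.quadraticTwist (NumberField.discr K : ℚ)).entireLFunction 1 ≠ 0 →
      (4 * (W.conductorNorm ℤ : ℤ)) ∣ β ^ 2 - NumberField.discr K → ¬ (3 : ℤ) ∣ Dt.c →
      ∀ (v : HeightOneSpectrum (𝓞 ℚ)) (s : ℕ), s ≤ padicValNat 3 (W.tamagawaNumberAt v) →
        ∀ (n : ℕ) (d : KolyvaginHeegnerData Dt β ι n), Squarefree n →
          (∀ ℓ ∈ n.primeFactors, Zhang2014.IsKolyvaginPrime (W.conductorNorm ℤ) W K 3 ℓ ∧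
            s ≤ Zhang2014.kolyvaginIndex W 3 ℓ) → PDiv d 3 s :=
  jetchevMaxHLAtThree_of_swapLiterature h372 hGZ hmod (poitouTate_conj_forall_of_selmerComplement_canonical hSC) hF1

end Summit.BirchSwinnertonDyer.Rank1Residual.X11b.Three.Koly

end
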